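import Summits.AtomisticToContinuum.HydrodynamicLimit.Theses.OneFlightGossipEngine
import Summits.AtomisticToContinuum.HydrodynamicLimit.Theorems.OneFlightGossipEngineClampedCurrentsDockClampRemainder
import Literature.Analysis.FluidPDE.HardSphereCollisionRecord
import Literature.Analysis.FluidPDE.HardSphereFlowJointMeasurable
import Literature.Analysis.FluidPDE.CollisionalTransfer
import Literature.Analysis.FunctionSpaces.TorusCalculusProofs
import Literature.MathematicalPhysics.KineticTheory.HardSphereEulerProofs
import Summits.AtomisticToContinuum.HydrodynamicLimit.Theorems.OneFlightGossipEngineClampedCurrentsDockCollisionalIdPrelim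
import HarnessLib

/-!
# The collisional identification on one window (stub `stub_collisionalIdentification`, CC1)

Crux `Summit.AtomisticToContinuum.HydrodynamicLimit.Theses.OneFlightGossipEngine.ClampedCurrentsDock`
(stmt-AtomisticToContinuum-14680), line `IdeatorTwoSketch`, stub CC1
`stub_collisionalIdentification : CollisionalIdentification`: PATHWISE algebra on one window `(0, w]` of a good
orbit of the hard-sphere flow with frozen smooth profiles `θ₀ > 0`, `u₀` and a continuous density `ρ₀` entering the
EOS coefficients `Z = hsCompressibility (ρ₀σ³)`, `Z′`. The EOS-projection integrands `P` of the Euler cancellation (S8)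
integrated over the window, minus the frozen pair kernel `K` of the pathwise entropy production (S2/C0) summed over
the collisions, equal minus the four CLAMPED, CENTRED functionals of `LocalClampedTransferWindowLDFamily` (momentum rows
with `φ_k = u₀_k/θ₀`, energy row with `φ_e = −θ₀⁻¹`) plus the centring total `w(N+1)∫ρ₀ηZ′ div u₀`, up to the clamp
remainder of S10, `|Rem| ≤ 2Lw Σ_i act_i 1{act_i > V}`.

STATEMENT NOTE (worker, v24 → v25). The registered v24 signature quantifies over an ARBITRARY continuous `ρ₀` but says
nothing about the equation of state `hsCompressibility = 1 + η · deriv hsExcessFreeEnergy η` (a `limsup`/`deriv`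
definition with no global regularity in the tree), so the coefficients `Z ∘ (ρ₀σ³)`, `Z′ ∘ (ρ₀σ³)` need not be locally
bounded, the window integrals `∫₀ʷ Σ_i P`, `Am`, `Ae` and the centring integrals over `𝕋³` need not exist, and the
linearity the identity rests on is unavailable (Bochner junk values). The def below is the registered one with TWO
hypotheses inserted after `Continuous ρ₀`:
`Continuous (fun x => hsCompressibility (ρ₀ x * σ ^ 3)) → Continuous (fun x => deriv hsCompressibility (ρ₀ x * σ ^ 3)) →`.
The heart discharges them in its EOS window (`AnalyticOnNhd ℝ F (Ioo (-η₁) η₁)`,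
`∀ η ∈ Ioo 0 η₁, hsCompressibility η = 1 + η * deriv F η`, `∀ x, ρ_s x * σ ^ 3 ∈ Ioo 0 η₁`): `hsCompressibility` is then
analytic on `Ioo 0 η₁` (cf. `analyticOnNhd_hsCompressibility` in `HardSphereEulerLocalTheoryProofs`), so
`hZan.continuousOn.comp_continuous` / `hZan.deriv.continuousOn.comp_continuous` give both.

Proof: (1) per record `K = ½{Σ_k (φ_k(x_fst) − φ_k(x_snd))Δv_k + (φ_e(x_fst) − φ_e(x_snd))Δe}`; (2) collision sums
over the finitely many collision times of a good orbit in the window are finite sums, hence additive; (3) clamp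
insertion `g = ω_fst ω_snd g + (1 − ω_fst ω_snd) g`, the first parts being the `Xm`/`Xe` of the statement and the rest
bounded by `ClampedCurrentsDockClampRemainder.abs_collisionSum_unclamped_le_transfer` (S10) with `B = L ε_N`
(contact pairs are at minimal-image distance `ε_N`, `Σ_k |Δv_k| ≤ 2‖Δv‖`), `(1 − ω_i)A_i = (τ/σ)·act_i 1{act_i > V}`
and `ε_N τ/σ = w`; (4) pointwise `P = Σ_k pAm_k + pAe` (torus quotient/inverse rules for `∂(u_k/θ)`, `∂(−θ⁻¹)`),
integrated using interval integrability of continuous one-body functionals along a good orbit (measurable in time,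
positions in the compact torus, velocities bounded by the conserved energy); (5) centring:
`θ₀[Σ_k ∂_k(u₀_k/θ₀) + u₀·∇(−θ₀⁻¹)] = div u₀` pointwise, integrated over `𝕋³`.
References: H.-T. Yau, Lett. Math. Phys. 22 (1991) §2; H. Spohn, *Large Scale Dynamics of Interacting Particles*
(1991), Part I §3.2.
-/

noncomputable section

namespace Summit.AtomisticToContinuum.HydrodynamicLimit.Theorems.ClampedCurrentsDockCollisionalId

open scoped BigOperators ENNReal Classical Interval
open MeasureTheory Filter Set Topology InformationTheory
open Literature.MathematicalPhysics.KineticTheory Literature.Analysis.FluidPDE Literature.Analysis.FunctionSpaces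
open Summit.AtomisticToContinuum.HydrodynamicLimit.Theses.OneFlightGossipEngine
open Summit.AtomisticToContinuum.HydrodynamicLimit.Theorems

/-! ## The statement -/

/-- registered stub signature CC1 of line IdeatorTwoSketch, crux ClampedCurrentsDock — route-internal, not a cited fact -/
def CollisionalIdentification : Prop :=
  ∀ (σ : ℝ) (N : ℕ) (Φ : HardSphereFlow (Torus.geometry (Fin 3)) (hsDiameter σ N) (N + 1))
    (θ₀ ρ₀ : T3 → ℝ) (u₀ : T3 → V3) (V τ L : ℝ), 0 < σ → σ < 1 / 2 → 0 < τ →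
    Torus.IsSmooth θ₀ → Torus.IsSmooth u₀ → Continuous ρ₀ →
    Continuous (fun x => hsCompressibility (ρ₀ x * σ ^ 3)) →
    Continuous (fun x => deriv hsCompressibility (ρ₀ x * σ ^ 3)) → (∀ x, 0 < θ₀ x) → 0 ≤ L →
    (∀ (k : Fin 3) (x y : T3), |u₀ x k / θ₀ x - u₀ y k / θ₀ y| ≤ L * Torus.euclidDist x y) →
    (∀ x y : T3, |(-(θ₀ x)⁻¹) - (-(θ₀ y)⁻¹)| ≤ L * Torus.euclidDist x y) →
    ∀ z ∈ Φ.good,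
      (let w : ℝ := τ * ((N : ℝ) + 1) ^ (-(1 / 3 : ℝ))
       let Z : T3 → ℝ := fun x => hsCompressibility (ρ₀ x * σ ^ 3)
       let Z' : T3 → ℝ := fun x => deriv hsCompressibility (ρ₀ x * σ ^ 3)
       let act := fun (i : Fin (N + 1)) (z : Config (N + 1) (Fin 3) T3) =>
         σ / τ * Φ.collisionSum (Set.Ioc 0 w) (fun c => if c.fst = i then
           ‖c.postVel.1 - c.preVel.1‖ + |‖c.postVel.1‖ ^ 2 - ‖c.preVel.1‖ ^ 2| / 2 else 0) z
       let ω := fun (i : Fin (N + 1)) (z : Config (N + 1) (Fin 3) T3) => if act i z ≤ V then (1 : ℝ) else 0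
       let Xm := fun (φ : T3 → ℝ) (k : Fin 3) (z : Config (N + 1) (Fin 3) T3) =>
         Φ.collisionSum (Set.Ioc 0 w)
           (fun c => ω c.fst z * ω c.snd z * ((φ c.fstPos - φ c.sndPos) * (c.postVel.1 k - c.preVel.1 k)) / 2) z
       let Am := fun (φ : T3 → ℝ) (k : Fin 3) (z : Config (N + 1) (Fin 3) T3) =>
         (∫ r in (0 : ℝ)..w, ∑ i : Fin (N + 1), Torus.partialDeriv k φ ((Φ.flow r z i).1) *
           (θ₀ ((Φ.flow r z i).1) * (ρ₀ ((Φ.flow r z i).1) * σ ^ 3) * Z' ((Φ.flow r z i).1) +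
             (1 / 3) * (Z ((Φ.flow r z i).1) - 1) * ‖((Φ.flow r z i).2) - u₀ ((Φ.flow r z i).1)‖ ^ 2)) -
         w * ((N : ℝ) + 1) * ∫ x, ρ₀ x * Torus.partialDeriv k φ x * (θ₀ x * (ρ₀ x * σ ^ 3) * Z' x)
       let Xe := fun (φ : T3 → ℝ) (z : Config (N + 1) (Fin 3) T3) =>
         Φ.collisionSum (Set.Ioc 0 w)
           (fun c => ω c.fst z * ω c.snd z *
             ((φ c.fstPos - φ c.sndPos) * ((‖c.postVel.1‖ ^ 2 - ‖c.preVel.1‖ ^ 2) / 2)) / 2) z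
       let Ae := fun (φ : T3 → ℝ) (z : Config (N + 1) (Fin 3) T3) =>
         (∫ r in (0 : ℝ)..w, ∑ i : Fin (N + 1),
           ((∑ l : Fin 3, u₀ ((Φ.flow r z i).1) l * Torus.partialDeriv l φ ((Φ.flow r z i).1)) *
               (θ₀ ((Φ.flow r z i).1) * (ρ₀ ((Φ.flow r z i).1) * σ ^ 3) * Z' ((Φ.flow r z i).1) +
                 (1 / 3) * (Z ((Φ.flow r z i).1) - 1) * ‖((Φ.flow r z i).2) - u₀ ((Φ.flow r z i).1)‖ ^ 2) +
             θ₀ ((Φ.flow r z i).1) * (Z ((Φ.flow r z i).1) - 1) *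
               (∑ l : Fin 3, Torus.partialDeriv l φ ((Φ.flow r z i).1) *
                 (((Φ.flow r z i).2) - u₀ ((Φ.flow r z i).1)) l))) -
         w * ((N : ℝ) + 1) *
           ∫ x, ρ₀ x * (∑ l : Fin 3, u₀ x l * Torus.partialDeriv l φ x) * (θ₀ x * (ρ₀ x * σ ^ 3) * Z' x)
       let P := fun (y : T3 × V3) =>
         (∑ k : Fin 3, Torus.partialDeriv k (fun x => u₀ x k / θ₀ x) y.1) *
           (θ₀ y.1 * (ρ₀ y.1 * σ ^ 3) * Z' y.1 + (1 / 3) * (Z y.1 - 1) * ‖y.2 - u₀ y.1‖ ^ 2) +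
         ((∑ k : Fin 3, u₀ y.1 k * Torus.partialDeriv k θ₀ y.1) / (θ₀ y.1) ^ 2) *
           (θ₀ y.1 * (ρ₀ y.1 * σ ^ 3) * Z' y.1 + (1 / 3) * (Z y.1 - 1) * ‖y.2 - u₀ y.1‖ ^ 2) +
         (Z y.1 - 1) * (∑ k : Fin 3, (y.2 - u₀ y.1) k * Torus.partialDeriv k θ₀ y.1) / θ₀ y.1
       let K := fun (c : HardSphereCollisionRecord (Fin 3) T3 (N + 1)) =>
         ((∑ k : Fin 3, (u₀ c.fstPos k / θ₀ c.fstPos - u₀ c.sndPos k / θ₀ c.sndPos) * (c.postVel.1 k - c.preVel.1 k)) -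
           ((θ₀ c.fstPos)⁻¹ - (θ₀ c.sndPos)⁻¹) * ((‖c.postVel.1‖ ^ 2 - ‖c.preVel.1‖ ^ 2) / 2)) / 2
       let Cst : ℝ := ∫ x, ρ₀ x * (ρ₀ x * σ ^ 3) * Z' x * Torus.divergence u₀ x
       ∃ Rem : ℝ, |Rem| ≤ 2 * L * w * ∑ i : Fin (N + 1), Set.indicator {y : ℝ | V < y} (fun y => y) (act i z) ∧
         (∫ r in (0 : ℝ)..w, ∑ i : Fin (N + 1), P (Φ.flow r z i)) - Φ.collisionSum (Set.Ioc 0 w) K z =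
           -((∑ k : Fin 3, (Xm (fun x => u₀ x k / θ₀ x) k z - Am (fun x => u₀ x k / θ₀ x) k z)) +
               (Xe (fun x => -(θ₀ x)⁻¹) z - Ae (fun x => -(θ₀ x)⁻¹) z)) +
             w * ((N : ℝ) + 1) * Cst + Rem)

open Summit.AtomisticToContinuum.HydrodynamicLimit.Theorems.ClampedCurrentsDockCollisionalIdPrelim

/-! ## §6 The stub -/

/-- **STUB `stub_collisionalIdentification`** (CC1) of line `IdeatorTwoSketch` (crux `ClampedCurrentsDock`,
stmt-AtomisticToContinuum-14680): the collisional identification on one window of a good orbit — kernel split per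
record, additivity of finite collision sums, clamp insertion with the S10 remainder (`B = Lε_N`, `ε_N τ/σ = w`),
the pointwise splitting `P = Σ_k pAm_k + pAe` integrated along the orbit, and the centring identity
`Σ_k c_k + c_e = w(N+1)∫ρ₀ηZ′ div u₀`. [folklore] -/
theorem stub_collisionalIdentification : CollisionalIdentification := by
  intro σ N Φ θ₀ ρ₀ u₀ V τ L hσ hσ2 hτ hθs hus hρ hZc hZ'c hθ0 hL hLm hLe z hz w Z Z' act ω Xm Am Xe Ae P K Cst
  /- basic facts -/
  have hσ0 : σ ≠ 0 := hσ.ne'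
  have hτ0 : τ ≠ 0 := hτ.ne'
  have hε0 : 0 < hsDiameter σ N := hsDiameter_pos hσ N
  have hεreg : (Torus.geometry (Fin 3)).IsHardSphereRegular (hsDiameter σ N) :=
    Torus.isHardSphereRegular_geometry ((hsDiameter_le hσ.le N).trans_lt (hσ2.trans_eq (by norm_num)))
  have hfin : (collisionTimes (Torus.geometry (Fin 3)) (hsDiameter σ N) (fun t => Φ.flow t z) ∩
      Set.Ioc 0 w).Finite := Φ.finite_collisionTimes_inter hz Set.Ioc_subset_Icc_self
  have hεw : hsDiameter σ N * τ / σ = w := by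
    simp only [w, hsDiameter]
    push_cast
    field_simp
  /- smoothness and continuity of the coefficients -/
  have hθ1 : Torus.IsContDiff 1 θ₀ := hθs.isContDiff (by simp)
  have huk : ∀ k, Torus.IsSmooth (fun x => u₀ x k) := fun k => hus.apply k
  have hφm : ∀ k, Torus.IsSmooth (fun x => u₀ x k / θ₀ x) := fun k =>
    (huk k).div hθs (fun y => (hθ0 _).ne')
  have hφe : Torus.IsSmooth (fun x => -(θ₀ x)⁻¹) := (hθs.inv fun y => (hθ0 _).ne').neg
  have hpd : ∀ k, Continuous (Torus.partialDeriv k (fun x => u₀ x k / θ₀ x)) := fun k =>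
    ((hφm k).partialDeriv k).continuous
  have hpe : ∀ l, Continuous (Torus.partialDeriv l (fun x => -(θ₀ x)⁻¹)) := fun l =>
    (hφe.partialDeriv l).continuous
  have hθc : Continuous θ₀ := hθs.continuous
  have huc : Continuous u₀ := hus.continuous
  have hZc' : Continuous Z := hZc
  have hZ'c' : Continuous Z' := hZ'c
  /- the derivative formulas for the test functions -/
  have hdm : ∀ (k : Fin 3) (x : T3), Torus.partialDeriv k (fun y => u₀ y k / θ₀ y) x =
      (Torus.partialDeriv k (fun y => u₀ y k) x * θ₀ x - u₀ x k * Torus.partialDeriv k θ₀ x) / θ₀ x ^ 2 :=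
    fun k x => partialDeriv_div ((huk k).isContDiff (by simp)) hθ1 (fun y => (hθ0 y).ne') k x
  have hde : ∀ (l : Fin 3) (x : T3), Torus.partialDeriv l (fun y => -(θ₀ y)⁻¹) x =
      Torus.partialDeriv l θ₀ x / θ₀ x ^ 2 :=
    fun l x => partialDeriv_neg_inv hθ1 (fun y => (hθ0 y).ne') l x
  /- the per-particle integrands of the rows and the centring integrands -/
  set pAm : Fin 3 → T3 × V3 → ℝ := fun k y => Torus.partialDeriv k (fun x => u₀ x k / θ₀ x) y.1 *
      (θ₀ y.1 * (ρ₀ y.1 * σ ^ 3) * Z' y.1 + (1 / 3) * (Z y.1 - 1) * ‖y.2 - u₀ y.1‖ ^ 2) with hpAm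
  set pAe : T3 × V3 → ℝ := fun y =>
      (∑ l : Fin 3, u₀ y.1 l * Torus.partialDeriv l (fun x => -(θ₀ x)⁻¹) y.1) *
          (θ₀ y.1 * (ρ₀ y.1 * σ ^ 3) * Z' y.1 + (1 / 3) * (Z y.1 - 1) * ‖y.2 - u₀ y.1‖ ^ 2) +
        θ₀ y.1 * (Z y.1 - 1) *
          (∑ l : Fin 3, Torus.partialDeriv l (fun x => -(θ₀ x)⁻¹) y.1 * (y.2 - u₀ y.1) l) with hpAe
  set fm : Fin 3 → T3 → ℝ := fun k x =>
      ρ₀ x * Torus.partialDeriv k (fun y => u₀ y k / θ₀ y) x * (θ₀ x * (ρ₀ x * σ ^ 3) * Z' x) with hfm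
  set fe : T3 → ℝ := fun x =>
      ρ₀ x * (∑ l : Fin 3, u₀ x l * Torus.partialDeriv l (fun y => -(θ₀ y)⁻¹) x) *
        (θ₀ x * (ρ₀ x * σ ^ 3) * Z' x) with hfe
  have hAm : ∀ k : Fin 3, Am (fun x => u₀ x k / θ₀ x) k z =
      (∫ r in (0 : ℝ)..w, ∑ i, pAm k (Φ.flow r z i)) - w * ((N : ℝ) + 1) * ∫ x, fm k x := fun k => rfl
  have hAe : Ae (fun x => -(θ₀ x)⁻¹) z =
      (∫ r in (0 : ℝ)..w, ∑ i, pAe (Φ.flow r z i)) - w * ((N : ℝ) + 1) * ∫ x, fe x := rfl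
  /- (4) STREAMING: `P = Σ_k pAm_k + pAe` pointwise, integrated along the orbit -/
  have hP : ∀ y, P y = (∑ k, pAm k y) + pAe y := by
    intro y
    have hθy : θ₀ y.1 ≠ 0 := (hθ0 y.1).ne'
    simp only [P, pAm, pAe, hde, Fin.sum_univ_three]
    field_simp
    ring
  have hpAm_cont : ∀ k, Continuous (pAm k) := fun k => continuous_rowIntegrand (hpd k) hθc hρ hZc' hZ'c' huc σ
  have hpAe_cont : Continuous pAe := continuous_energyIntegrand hpe hθc hρ hZc' hZ'c' huc σ
  have hIm : ∀ k, IntervalIntegrable (fun r => ∑ i, pAm k (Φ.flow r z i)) volume 0 w := fun k =>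
    intervalIntegrable_sum_orbit Φ hz (hpAm_cont k) 0 w
  have hIe : IntervalIntegrable (fun r => ∑ i, pAe (Φ.flow r z i)) volume 0 w :=
    intervalIntegrable_sum_orbit Φ hz hpAe_cont 0 w
  have hsplit : (∫ r in (0 : ℝ)..w, ∑ i, P (Φ.flow r z i)) =
      (∑ k, ∫ r in (0 : ℝ)..w, ∑ i, pAm k (Φ.flow r z i)) + ∫ r in (0 : ℝ)..w, ∑ i, pAe (Φ.flow r z i) := by
    have hfun : (fun r => ∑ i, P (Φ.flow r z i)) =
        fun r => (∑ k, ∑ i, pAm k (Φ.flow r z i)) + ∑ i, pAe (Φ.flow r z i) := by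
      funext r
      simp only [hP, Finset.sum_add_distrib]
      rw [Finset.sum_comm]
    rw [hfun, intervalIntegral.integral_add (intervalIntegrable_finset_sum _ fun k _ => hIm k) hIe,
      intervalIntegral.integral_finsetSum fun k _ => hIm k]
  /- (5) CENTRING: `Σ_k c_k + c_e = w (N+1) Cst` -/
  have hIfm : ∀ k, Integrable (fm k) := fun k =>
    integrable_of_continuous_T3 (continuous_rowCentring (hpd k) hθc hρ hZ'c' σ)
  have hIfe : Integrable fe := integrable_of_continuous_T3 (continuous_energyCentring hpe hθc hρ hZ'c' huc σ)
  have hpt : ∀ x, (∑ k, fm k x) + fe x = ρ₀ x * (ρ₀ x * σ ^ 3) * Z' x * Torus.divergence u₀ x := by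
    intro x
    have hθx : θ₀ x ≠ 0 := (hθ0 x).ne'
    simp only [fm, fe, hdm, hde, Torus.divergence, Fin.sum_univ_three]
    field_simp
    ring
  have hcen : (∑ k, w * ((N : ℝ) + 1) * ∫ x, fm k x) + w * ((N : ℝ) + 1) * ∫ x, fe x =
      w * ((N : ℝ) + 1) * Cst := by
    have h1 : (∑ k, ∫ x, fm k x) + ∫ x, fe x = ∫ x, ρ₀ x * (ρ₀ x * σ ^ 3) * Z' x * Torus.divergence u₀ x := by
      rw [← integral_finsetSum _ fun k _ => hIfm k,
        ← integral_add (integrable_finsetSum _ fun k _ => hIfm k) hIfe]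
      exact integral_congr_ae (ae_of_all _ hpt)
    simp only [Cst]
    rw [← Finset.mul_sum, ← mul_add, h1]
  /- (1)+(2) KERNEL: the clamped parts are `Σ_k Xm_k + Xe = Σ_c ω_fst ω_snd K` -/
  have hX : (∑ k : Fin 3, Xm (fun x => u₀ x k / θ₀ x) k z) + Xe (fun x => -(θ₀ x)⁻¹) z =
      Φ.collisionSum (Set.Ioc 0 w) (fun c => ω c.fst z * ω c.snd z * K c) z := by
    simp only [Xm, Xe, HardSphereFlow.collisionSum_eq]
    rw [← collisionSum_finset_sum hfin, ← collisionSum_add hfin]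
    congr 1
    funext c
    simp only [K, Fin.sum_univ_three]
    ring
  /- (3) CLAMP INSERTION: the remainder and its bound by S10 -/
  set Rem : ℝ := Φ.collisionSum (Set.Ioc 0 w) (fun c => ω c.fst z * ω c.snd z * K c) z -
    Φ.collisionSum (Set.Ioc 0 w) K z with hRem_def
  have hRem_eq : Rem = -collisionSum (Torus.geometry (Fin 3)) (hsDiameter σ N) (fun t => Φ.flow t z)
      (Set.Ioc 0 w) (fun c => (1 - ω c.fst z * ω c.snd z) * K c) := by
    rw [hRem_def, HardSphereFlow.collisionSum_eq, HardSphereFlow.collisionSum_eq,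
      show (fun c => (1 - ω c.fst z * ω c.snd z) * K c) =
        fun c => K c - ω c.fst z * ω c.snd z * K c from funext fun c => by ring,
      collisionSum_sub hfin]
    ring
  have hω0 : ∀ i, 0 ≤ ω i z := fun i => by
    simp only [ω]
    split_ifs <;> norm_num
  have hω1 : ∀ i, ω i z ≤ 1 := fun i => by
    simp only [ω]
    split_ifs <;> norm_num
  have hg : ∀ t ∈ collisionTimes (Torus.geometry (Fin 3)) (hsDiameter σ N) (fun t => Φ.flow t z) ∩ Set.Ioc 0 w,
      ∀ p ∈ contactPairs (Torus.geometry (Fin 3)) (hsDiameter σ N) (Φ.flow t z),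
      |K (HardSphereCollisionRecord.ofConfig (Torus.geometry (Fin 3)) (hsDiameter σ N) (Φ.flow t z) t p.1 p.2)| ≤
        L * hsDiameter σ N *
          (‖(HardSphereCollisionRecord.ofConfig (Torus.geometry (Fin 3)) (hsDiameter σ N)
                (Φ.flow t z) t p.1 p.2).postVel.1 -
              (HardSphereCollisionRecord.ofConfig (Torus.geometry (Fin 3)) (hsDiameter σ N)
                (Φ.flow t z) t p.1 p.2).preVel.1‖ +
            |‖(HardSphereCollisionRecord.ofConfig (Torus.geometry (Fin 3)) (hsDiameter σ N)
                  (Φ.flow t z) t p.1 p.2).postVel.1‖ ^ 2 -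
                ‖(HardSphereCollisionRecord.ofConfig (Torus.geometry (Fin 3)) (hsDiameter σ N)
                  (Φ.flow t z) t p.1 p.2).preVel.1‖ ^ 2| / 2) := by
    intro t _ p hp
    have hc := (mem_contactPairs.1 hp).2
    have hdist : Torus.euclidDist (Φ.flow t z p.1).1 (Φ.flow t z p.2).1 = hsDiameter σ N :=
      (mem_contactSet.1 hc).2
    exact abs_pairKernel_le hL hε0.le hLm hLe _ hdist.le
  have hS10 : |collisionSum (Torus.geometry (Fin 3)) (hsDiameter σ N) (fun t => Φ.flow t z) (Set.Ioc 0 w)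
      (fun c => (1 - ω c.fst z * ω c.snd z) * K c)| ≤ 2 * (L * hsDiameter σ N) * ∑ i, (1 - ω i z) *
        collisionSum (Torus.geometry (Fin 3)) (hsDiameter σ N) (fun t => Φ.flow t z) (Set.Ioc 0 w)
          (fun c => if c.fst = i then
            ‖c.postVel.1 - c.preVel.1‖ + |‖c.postVel.1‖ ^ 2 - ‖c.preVel.1‖ ^ 2| / 2 else 0) :=
    ClampedCurrentsDockClampRemainder.abs_collisionSum_unclamped_le_transfer (ω := fun i => ω i z)
      (g := fun c => K c) hεreg hfin hω0 hω1 hg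
  have hA : ∀ i, (1 - ω i z) *
      collisionSum (Torus.geometry (Fin 3)) (hsDiameter σ N) (fun t => Φ.flow t z) (Set.Ioc 0 w)
        (fun c => if c.fst = i then
          ‖c.postVel.1 - c.preVel.1‖ + |‖c.postVel.1‖ ^ 2 - ‖c.preVel.1‖ ^ 2| / 2 else 0) =
      τ / σ * Set.indicator {y : ℝ | V < y} (fun y => y) (act i z) := by
    intro i
    simp only [ω, act, HardSphereFlow.collisionSum_eq]
    split_ifs with h
    · rw [Set.indicator_of_notMem (by simpa only [Set.mem_setOf_eq, not_lt] using h)]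
      ring
    · rw [Set.indicator_of_mem (by simpa only [Set.mem_setOf_eq, not_le] using h), ← mul_assoc,
        show τ / σ * (σ / τ) = (1 : ℝ) by field_simp]
      ring
  have hbound : |Rem| ≤ 2 * L * w * ∑ i, Set.indicator {y : ℝ | V < y} (fun y => y) (act i z) := by
    rw [hRem_eq, abs_neg]
    refine hS10.trans (le_of_eq ?_)
    rw [Finset.mul_sum, Finset.mul_sum]
    refine Finset.sum_congr rfl fun i _ => ?_
    rw [hA i, ← hεw]
    ring
  /- assembly -/
  refine ⟨Rem, hbound, ?_⟩
  rw [Finset.sum_sub_distrib, hAe]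
  simp only [hAm]
  rw [Finset.sum_sub_distrib]
  linear_combination hsplit + hX + hcen - hRem_def

end Summit.AtomisticToContinuum.HydrodynamicLimit.Theorems.ClampedCurrentsDockCollisionalId

end
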